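import Mathlib.Tactic

/-!
# The critical twist of the fourfold line bundle: bookkeeping identities

Pure algebraic, arithmetic and finite identities behind the W4 note `FOURFOLD-w4rep2g14.md`
(pub-hsemireg, W4, w4-rep-2 gen 14) and the errata block `NINE-w4rep2g13.md` §20.

Setting (informal; nothing of it is formalised here): a cell `(n; m, 3m)` with `s = 2m - n`,
`t = 2n - 3m`; the B-side bundle of the cell is the direct image of ONE line bundle `𝓛_k` from the
abelian fourfold `B × X̄`, whose Hermitian form is `H₀ ⊗ S_k` with
`S_k = ((m/n + k, -k), (-k, k - 2/3))`; the A-side bundle comes from `B × Y₁` with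
`S''_k = ((m/n + k, -k), (-k, k - 1/2))`.  Below: the determinants of `S_k`, `S''_k` cleared of
denominators (`det_S_cleared`, `det_S''_cleared`: they vanish exactly at the critical twists
`t k + 2 m = 0` and `s k = m`), the null vectors `(2n, 3m)` and `(n, 2m)` at the critical twists,
the harmonic slope law of the Pontrjagin product, the Euler-characteristic identity behind the
corrected two-regime table (`chi_two_regime`, `h1_at_level_one`), the multiplicities
`(3k* - 2)² / n²` resp. `/16n²` in the three integral cases, and the arithmetic lemma that the
critical twist `k* = 2m/|t|` is integral only for `|t| ∈ {1, 2, 4}` (`abs_t_eq_one_of_odd`,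
`natAbs_t_le_of_even`, `critical_twist_cases`), plus the Pell datum `(7, 2)` of `x² - 12 y² = 1` with its band `(1/2, 2/3)`, and the block
arithmetic of the `k*` row (`critical_level`, `block_shape`, `honest_level_t1/t4`, `heisenberg_level_t2`).
Honest framing: identities only; nothing here says HC / HC_CM / HC_AV is proved.
-/

namespace Summit.Ventures.HSemireg.CriticalTwistBookkeeping

section Ring

variable {R : Type*} [CommRing R]

/-- `det S_k` cleared of the denominator `3n`:
`(m + n k)(3k - 2) - 3 n k² = -(t k + 2m)` with `t = 2n - 3m`.  So the B-side form degenerates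
exactly at `t k + 2 m = 0`, i.e. `k = k* = 2m/(3m - 2n)`. -/
theorem det_S_cleared (m n k : R) :
    (m + n * k) * (3 * k - 2) - 3 * n * k ^ 2 = -((2 * n - 3 * m) * k + 2 * m) := by
  ring

/-- `det S''_k` cleared of the denominator `2n`: `(m + n k)(2k - 1) - 2 n k² = s k - m`
with `s = 2m - n`.  The A-side form degenerates exactly at `s k = m`. -/
theorem det_S''_cleared (m n k : R) :
    (m + n * k) * (2 * k - 1) - 2 * n * k ^ 2 = (2 * m - n) * k - m := by
  ring

/-- The null vector of the B-side form at the critical twist is `(b, x) ∝ (2n, 3m)`: the first row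
`(m/n + k)·2n - k·3m = t k + 2 m` is, cleared of denominators, literally
`Summit.Ventures.HSemireg.TwoRegimeLaw.theoremI_threshold` (already landed; not restated here); the
second row `-k·2n + (k - 2/3)·3m` reads `3 m k - 2 m - 2 n k = -(t k + 2 m)`. -/
theorem null_vector_B (m n k : R) :
    3 * m * k - 2 * m - 2 * n * k = -((2 * n - 3 * m) * k + 2 * m) := by
  ring

/-- The null vector of the A-side form at `s k = m` is `(b, y) ∝ (n, 2m)`:
`(m + n k) - 2 m k = m - s k` and `2 m k - m - n k = s k - m`. -/
theorem null_vector_A (m n k : R) :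
    (m + n * k) - 2 * m * k = m - (2 * m - n) * k ∧
      2 * m * k - m - n * k = (2 * m - n) * k - m := by
  constructor <;> ring

/-- Restricted to the fibre direction `b = x` the B-side form is `(m/n - 2/3) H₀`; cleared of
`3n`: the sum of the four entries of `3n · S_k` is `3m - 2n = -t`, independent of `k`. -/
theorem fibre_class_B (m n k : R) :
    3 * (m + n * k) - 3 * n * k - 3 * n * k + n * (3 * k - 2) = -(2 * n - 3 * m) := by
  ring

/-- Likewise on the A-side: the entries of `2n · S''_k` sum to `2m - n = s`. -/
theorem fibre_class_A (m n k : R) :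
    2 * (m + n * k) - 2 * n * k - 2 * n * k + n * (2 * k - 1) = 2 * m - n := by
  ring

/-- The Euler characteristic of the kernel sheaf twisted by `N̄^k`:
`9 m² k² - 3 (m + n k)² = 9 (s k - m)² - 3 (t k + 2 m)²` — the A-side Pfaffian minus the
B-side Pfaffian. -/
theorem chi_two_regime (m n k : R) :
    9 * m ^ 2 * k ^ 2 - 3 * (m + n * k) ^ 2 =
      9 * ((2 * m - n) * k - m) ^ 2 - 3 * ((2 * n - 3 * m) * k + 2 * m) ^ 2 := by
  ring

/-- ERRATUM E-REP2-14-2 (the `h¹` at level one): `3 (t + 2m)² - 9 (s - m)² = 3 (n² + 2 m n - 2 m²)`. -/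
theorem h1_at_level_one (m n : R) :
    3 * ((2 * n - 3 * m) + 2 * m) ^ 2 - 9 * ((2 * m - n) - m) ^ 2 =
      3 * (n ^ 2 + 2 * m * n - 2 * m ^ 2) := by
  ring

/-- The two numerical instances quoted in the erratum: `(5;4,12) ↦ 99`, `(7;5,15) ↦ 207`. -/
theorem h1_at_level_one_instances :
    3 * ((5 : ℤ) ^ 2 + 2 * 4 * 5 - 2 * 4 ^ 2) = 99 ∧
      3 * ((7 : ℤ) ^ 2 + 2 * 5 * 7 - 2 * 5 ^ 2) = 207 := by
  norm_num

end Ring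

section Slopes

/-- The harmonic slope law of the Pontrjagin product (PROPOSITION L3 of the NINE note), B-side, in
reciprocal form `1/δ = 1/λ + 1/μ`: with `λ = -2/3`, `μ = m/n` one gets `1/δ = t/(2m)`, i.e.
`δ = 2m/t`, `t = 2n - 3m`. -/
theorem harmonic_slope_B (m n : ℚ) (hm : m ≠ 0) :
    (-3 : ℚ) / 2 + n / m = (2 * n - 3 * m) / (2 * m) := by
  field_simp
  ring

/-- A-side: `λ = -1/2`, `μ = m/n` give `1/δ = -2 + n/m = -s/m`, i.e. `δ = -m/s`, `s = 2m - n`. -/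
theorem harmonic_slope_A (m n : ℚ) (hm : m ≠ 0) :
    (-2 : ℚ) + n / m = -(2 * m - n) / m := by
  field_simp
  ring

end Slopes

section Multiplicities

/-- Case `|t| = 2` (`2n = 3m - 2`, `k* = m`): the multiplicity `(3k* - 2)²/n²` equals `4`. -/
theorem multiplicity_t2 (m n : ℤ) (h : 2 * n = 3 * m - 2) : (3 * m - 2) ^ 2 = 4 * n ^ 2 := by
  have : 3 * m - 2 = 2 * n := by omega
  rw [this]; ring

/-- Case `|t| = 4` (`2n = 3m - 4`, `k* = m/2`): `(3k* - 2)² / n² = 1`, i.e. `(3m - 4)² = 4n²`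
(both sides scaled by `4`). -/
theorem multiplicity_t4 (m n : ℤ) (h : 2 * n = 3 * m - 4) : (3 * m - 4) ^ 2 = 4 * n ^ 2 := by
  have : 3 * m - 4 = 2 * n := by omega
  rw [this]; ring

/-- Case `|t| = 1` (`2n = 3m - 1`, `k* = 2m`): `(3k* - 2)² / (16 n²) = 1`, i.e. `(6m - 2)² = 16 n²`. -/
theorem multiplicity_t1 (m n : ℤ) (h : 2 * n = 3 * m - 1) : (6 * m - 2) ^ 2 = 16 * n ^ 2 := by
  have : 6 * m - 2 = 4 * n := by omega
  rw [this]; ring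

/-- In each case the number of points of the jump set times the multiplicity is the rank `t²`:
`1·1 = 1²`, `1·4 = 2²`, `16·1 = 4²`; and on the A-side `1·3 = 3 = 3s²` for `s = 1`. -/
theorem points_times_multiplicity :
    1 * 1 = (1 : ℕ) ^ 2 ∧ 1 * 4 = (2 : ℕ) ^ 2 ∧ 16 * 1 = (4 : ℕ) ^ 2 ∧ 1 * 3 = 3 * (1 : ℕ) ^ 2 := by
  norm_num

end Multiplicities

section Integrality

/-- `m` odd: the critical twist `k* = 2m/|t|` is integral only when `|t| = 1`.
Precisely: if `m` is odd, `m, n` are coprime and `t = 2n - 3m` divides `2m`, then `t = ±1`. -/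
theorem abs_t_eq_one_of_odd (m n : ℤ) (hcop : IsCoprime m n) (hodd : Odd m)
    (hdiv : (2 * n - 3 * m) ∣ 2 * m) : 2 * n - 3 * m = 1 ∨ 2 * n - 3 * m = -1 := by
  set t := 2 * n - 3 * m with ht
  have todd : Odd t := by
    obtain ⟨j, hj⟩ := hodd
    exact ⟨n - 3 * j - 2, by omega⟩
  -- an odd divisor of `2a` divides `a` (folklore; cf. the landed
  -- `Literature.NumberTheory.EllipticCurves.dvd_of_odd_dvd_two_mul`, not imported here)
  have hodd2 : ∀ a : ℤ, t ∣ 2 * a → t ∣ a := by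
    intro a h
    obtain ⟨c, hc⟩ := h
    have hev : Even (t * c) := ⟨a, by linarith⟩
    rcases Int.even_mul.mp hev with h1 | h2
    · exact absurd h1 (Int.not_even_iff_odd.mpr todd)
    · obtain ⟨d, hd⟩ := h2
      refine ⟨d, ?_⟩
      have h3 : t * c = 2 * (t * d) := by rw [hd]; ring
      linarith
  have htm : t ∣ m := hodd2 m hdiv
  have ht2n : t ∣ 2 * n := by
    have : 2 * n = t + 3 * m := by omega
    rw [this]
    exact dvd_add dvd_rfl (dvd_mul_of_dvd_right htm 3)
  have htn : t ∣ n := hodd2 n ht2n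
  have hunit : IsUnit t := by
    obtain ⟨u, v, huv⟩ := hcop
    have : t ∣ u * m + v * n := dvd_add (dvd_mul_of_dvd_right htm u) (dvd_mul_of_dvd_right htn v)
    rw [huv] at this
    exact isUnit_of_dvd_one this
  exact Int.isUnit_iff.mp hunit

/-- `m = 2m'` even: if `m, n` are coprime and `t = 2n - 3m = 2(n - 3m')` divides `2m = 4m'`, then
`n - 3m'` divides `2`, so `|t| ∈ {2, 4}`. -/
theorem natAbs_t_le_of_even (m' n : ℤ) (hcop : IsCoprime (2 * m') n)
    (hdiv : (2 * n - 3 * (2 * m')) ∣ 2 * (2 * m')) : (n - 3 * m') ∣ 2 := by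
  have hc : IsCoprime (n - 3 * m') m' := by
    have h1 : IsCoprime n m' := (IsCoprime.of_mul_left_right hcop).symm
    have h2 := h1.add_mul_right_left (-3)
    have : n + -3 * m' = n - 3 * m' := by ring
    rw [this] at h2
    exact h2
  have hd : (n - 3 * m') ∣ 2 * m' := by
    obtain ⟨c, hc'⟩ := hdiv
    exact ⟨c, by linarith⟩
  exact hc.dvd_of_dvd_mul_right hd

/-- A divisor of `2` in `ℤ` has absolute value `1` or `2`; with the previous lemma, `|t| = 2|n - 3m'| ∈ {2, 4}`. -/
theorem natAbs_of_dvd_two {d : ℤ} (h : d ∣ 2) : d.natAbs = 1 ∨ d.natAbs = 2 := by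
  have h2 : d.natAbs ∣ 2 := by
    have := Int.natAbs_dvd_natAbs.mpr h
    simpa using this
  have hle : d.natAbs ≤ 2 := Nat.le_of_dvd (by norm_num) h2
  have hne : d.natAbs ≠ 0 := by
    intro h0
    rw [h0] at h2
    norm_num at h2
  interval_cases hd : d.natAbs <;> simp_all

/-- THE INTEGRALITY OF THE CRITICAL TWIST: for coprime `m, n` with `t = 2n - 3m` dividing `2m`
(i.e. `k* = 2m/|t| ∈ ℤ`), `|t| ∈ {1, 2, 4}` — `1` when `m` is odd, `2` or `4` when `m` is even. -/
theorem critical_twist_cases (m n : ℤ) (hcop : IsCoprime m n)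
    (hdiv : (2 * n - 3 * m) ∣ 2 * m) :
    (2 * n - 3 * m).natAbs = 1 ∨ (2 * n - 3 * m).natAbs = 2 ∨ (2 * n - 3 * m).natAbs = 4 := by
  rcases Int.even_or_odd m with ⟨m', hm'⟩ | hodd
  · have hm2 : m = 2 * m' := by omega
    subst hm2
    have hd : (n - 3 * m') ∣ 2 := natAbs_t_le_of_even m' n hcop hdiv
    have ht : (2 * n - 3 * (2 * m')) = 2 * (n - 3 * m') := by ring
    rw [ht, Int.natAbs_mul]
    rcases natAbs_of_dvd_two hd with h1 | h2
    · right; left; rw [h1]; norm_num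
    · right; right; rw [h2]; norm_num
  · left
    rcases abs_t_eq_one_of_odd m n hcop hodd hdiv with h | h <;> rw [h] <;> norm_num

end Integrality

section Pell

/-- The minimal solution of `x² - 12 y² = 1` is `(7, 2)`: it is a solution, and `y = 1` gives no
solution (`13` is not a square). -/
theorem pell_twelve : (7 : ℤ) ^ 2 - 12 * 2 ^ 2 = 1 ∧ ∀ x : ℕ, x ^ 2 ≠ 13 := by
  refine ⟨by norm_num, fun x hx => ?_⟩
  have hx4 : x < 4 := by nlinarith
  interval_cases x <;> omega

/-- The band of Ito's resolution for `d = 3`: `2 y₀/(x₀ + 1) = 1/2` and `2 y₀/(x₀ - 1) = 2/3`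
for `(x₀, y₀) = (7, 2)`; and the ranks `(x₀ - 1)/2 = 3`, `(x₀ + 1)/2 = 4`. -/
theorem ito_band : (2 * 2 : ℚ) / (7 + 1) = 1 / 2 ∧ (2 * 2 : ℚ) / (7 - 1) = 2 / 3 ∧
    ((7 : ℤ) - 1) / 2 = 3 ∧ ((7 : ℤ) + 1) / 2 = 4 := by
  norm_num

/-- The Euler characteristics of the two twisted summands of PROPOSITION L1 of the NINE note:
`χ(𝒢 ⊗ E₁) = 4 n² · 3 (m/n - 1/2)² = 3 s²` and `χ(𝒢 ⊗ E₂) = 3 n² · 3 (m/n - 2/3)² = t²`. -/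
theorem L1_characteristics (m n : ℚ) (hn : n ≠ 0) :
    4 * n ^ 2 * (3 * (m / n - 1 / 2) ^ 2) = 3 * (2 * m - n) ^ 2 ∧
      3 * n ^ 2 * (3 * (m / n - 2 / 3) ^ 2) = (2 * n - 3 * m) ^ 2 := by
  constructor <;> field_simp <;> ring

end Pell

section Blocks

variable {R : Type*} [CommRing R]

/-- At the critical twist the level `c = m + n k` equals `3 m k / 2`: `2 (m + n k) = 3 m k` whenever
`t k + 2 m = 0` (this is `TwoRegimeLaw.theoremI_threshold` read at `k*`; stated here as the implication
used for the block count `3 c² = 27 (m k / 2)²`, `9 m² k² = 36 (m k / 2)²`). -/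
theorem critical_level (m n k : R) (h : (2 * n - 3 * m) * k + 2 * m = 0) :
    2 * (m + n * k) = 3 * m * k := by
  linear_combination h

/-- The block shape `36 → 27`: with `2c = 3mk`, `4 · 9 m² k² = 36 (m k)²` and `4 · 3 c² = 27 (m k)²`. -/
theorem block_shape (m k c : R) (h : 2 * c = 3 * m * k) :
    4 * (9 * m ^ 2 * k ^ 2) = 36 * (m * k) ^ 2 ∧ 4 * (3 * c ^ 2) = 27 * (m * k) ^ 2 := by
  refine ⟨by ring, ?_⟩
  have h2 : (2 * c) ^ 2 = (3 * m * k) ^ 2 := by rw [h]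
  linear_combination (3 : R) * h2

/-- Honest action of `B[g]` at level `c` needs `g² ∣ c`.  Case `|t| = 1` (`k* = 2m`, `g = m`):
`c = m + n · 2m` with `2n = 3m - 1` gives `c = 3 m² = 3 g²`. -/
theorem honest_level_t1 (m n : ℤ) (h : 2 * n = 3 * m - 1) : m + n * (2 * m) = 3 * m ^ 2 := by
  linear_combination m * h

/-- Case `|t| = 4` (`m = 2g`, `k* = g`): `c = m + n g` with `2n = 3m - 4 = 6g - 4` gives `2c = 6 g²`,
i.e. `c = 3 g²`. -/
theorem honest_level_t4 (g n : ℤ) (h : 2 * n = 6 * g - 4) : 2 * (2 * g + n * g) = 2 * (3 * g ^ 2) := by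
  linear_combination g * h

/-- Case `|t| = 2` (`k* = m = g`): `2c = 2(m + n m) = 3 m²` with `2n = 3m - 2`, so `c = 3g²/2` is NOT a
multiple of `g² = m²` (the ratio is `3/2`): the action carries a Heisenberg cocycle — LEMMA H4's `mod 4`. -/
theorem heisenberg_level_t2 (m n : ℤ) (h : 2 * n = 3 * m - 2) : 2 * (m + n * m) = 3 * m ^ 2 := by
  linear_combination m * h

end Blocks

end Summit.Ventures.HSemireg.CriticalTwistBookkeeping
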